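import Mathlib
import Summits.ResolutionOfSingularities.ResolutionOfSingularities.Theorems.HomologicalConductorPersistenceSurfaceCompletedStep
import Summits.ResolutionOfSingularities.ResolutionOfSingularities.Theorems.HomologicalConductorPersistenceSurfaceTowerDim
import Literature.AlgebraicGeometry.Resolution.AdicCompletionRegular
import Literature.RingTheory.CohomologyAnnihilator.RegularLocalRing
import HarnessLib

/-!
# Rung S-2 `PersistenceSurface` (stmt-ResolutionOfSingularities-19970) — w44b-o12′, follow-up:
# the completed-step conjecture CSP″ REDUCES TO THE STEPS INTO A SINGULAR STAGE

Route `ResolutionOfSingularities/HomologicalConductor`, chain W4.4b (cell `res-hironaka`), rung S-2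
`PersistenceSurface` (stmt-ResolutionOfSingularities-19970), door L₄R♮ re-founded on COMPLETED PERSISTENCE
(CHAIN w44b v12, o12′; typed conjecture `CompletedStepPersistenceRationalNormal` = CSP″ and the S-2 door
`persistenceSurface_of_residual₂_of_completedStep_of_rest`, p519677). OURS; nothing here is a statement of
the manuscript under review (Hironaka 2017); AI-written, weaker than expert review. Filed
`--supports stmt-ResolutionOfSingularities-19970 --as helper` by res-type-010 (o12′ hand, follow-up).

This file transposes the o10a bookkeeping of the abandoned cover route
(`rationalNormalStepDualCover_of_singularSteps`, `…PersistenceSurfaceStepAddCover`) to the completed-step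
door: **the typed conjecture CSP″ has content only at the steps `T_m → T_(m+1)` whose target stage is NOT a
regular local ring** — at a regular target the completed clause is automatic:

* `mem_cohomologyAnnihilatorOfDegree_four_adicCompletion_of_isRegularLocalRing` — for a regular local ring
  `T'` of Krull dimension `≤ 3`, EVERY element of the completion `T̂' = AdicCompletion 𝔪 T'` lies in
  `ca⁴(T̂')`: the completion is again regular local of the same dimension `d ≤ 3`
  (`Resolution.isRegularLocalRing_adicCompletion`, `Resolution.ringKrullDim_adicCompletion`, Matsumura §19),
  so `caᵈ⁺¹(T̂') = ⊤` (Serre; `cohomologyAnnihilatorOfDegree_eq_top_of_isRegularLocalRing`) and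
  `caᵈ⁺¹ ⊆ ca⁴`;
* `algebraMap_mem_cohomologyAnnihilatorOfDegree_four_adicCompletion_of_isRegularLocalRing` — in particular
  the image of every `y : T'`;
* `completedStepPersistenceRationalNormal_of_singularSteps` — along the canonical normalised `ca`-tower of a
  surface datum (binders verbatim those of CSP″) every stage has Krull dimension `≤ 2`
  (`ringKrullDim_tower_le_of_ringKrullDim_le`, p-lineage `…PersistenceSurfaceTowerDim`), hence **CSP″
  follows from its restriction to the steps whose target stage `T_(m+1)` is NOT regular** — the residual the
  memo-level chain (BHST 4.5 (2) ascent + (1.1) + (VAL) + (Rec), res-L1-w44b-tri-1 DC-CUSTODY v2.1 §8)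
  addresses; at regular target stages the clause is vacuous-true by Serre, NOT by the conjecture.

References: res-L1-w44b-plan-1 CHAIN w44b v12 (o12′) (OURS); H. Matsumura, *Commutative Ring Theory* (1986),
Thm. 19.2 / §19 p. 158 (completion of a regular local ring); S. B. Iyengar, R. Takahashi, *Annihilation of
cohomology and strong generation of module categories*, IMRN 2016, Example 2.5 — context for the facts cited
by name.
-/

set_option linter.dupNamespace false -- mandated namespace `Summit.<Summit>.<Problem>` of this single-conjunct summit

noncomputable section

namespace Summit.ResolutionOfSingularities.ResolutionOfSingularities.Theorems.HomologicalConductor.PersistenceSurfaceCompletedStep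

open IsLocalRing Literature.RingTheory.CohomologyAnnihilator
open Summit.ResolutionOfSingularities.ResolutionOfSingularities.Theorems.NoZeno.Birth
open Summit.ResolutionOfSingularities.ResolutionOfSingularities.Theorems.HomologicalConductor.PersistenceSurfaceTowerDim

/-! ## Regular target stages: the completed clause is automatic -/

/-- **Serre at the completion.** If `T'` is a regular local ring of Krull dimension `≤ 3`, then EVERY element
of its `𝔪`-adic completion `T̂'` lies in `ca⁴(T̂')`: `T̂'` is regular local of the same dimension `d ≤ 3`, so
`caᵈ⁺¹(T̂') = ⊤ ⊆ ca⁴(T̂')`. [cite: Matsumura1987, §19 p. 158 (proof of Thm. 19.5)] -/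
theorem mem_cohomologyAnnihilatorOfDegree_four_adicCompletion_of_isRegularLocalRing
    {T' : Type} [CommRing T'] [IsRegularLocalRing T'] (h3 : ringKrullDim T' ≤ (3 : ℕ))
    (z : AdicCompletion (maximalIdeal T') T') :
    z ∈ cohomologyAnnihilatorOfDegree (AdicCompletion (maximalIdeal T') T') 4 := by
  haveI := Literature.AlgebraicGeometry.Resolution.isRegularLocalRing_adicCompletion T'
  obtain ⟨d, hd⟩ := Literature.AlgebraicGeometry.Resolution.ringKrullDim_eq_nat (R := T')
  have hd3 : d ≤ 3 := by
    rw [hd] at h3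
    exact_mod_cast h3
  have hd' : ringKrullDim (AdicCompletion (maximalIdeal T') T') = d := by
    rw [Literature.AlgebraicGeometry.Resolution.ringKrullDim_adicCompletion, hd]
  have htop := cohomologyAnnihilatorOfDegree_eq_top_of_isRegularLocalRing
    (AdicCompletion (maximalIdeal T') T') hd'
  have hle : cohomologyAnnihilatorOfDegree (AdicCompletion (maximalIdeal T') T') (d + 1) ≤
      cohomologyAnnihilatorOfDegree (AdicCompletion (maximalIdeal T') T') 4 :=
    cohomologyAnnihilatorOfDegree_mono (by omega)
  exact hle (htop ▸ Submodule.mem_top)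

/-- **The completed-step clause at a regular target stage.** If `T'` is a regular local ring of Krull
dimension `≤ 3`, the image in `T̂'` of every `y : T'` lies in `ca⁴(T̂')` — whatever `y` is, and in particular
for the images of `ca⁴` of the previous stage. [cite: IyengarTakahashi2014, Example 2.5] -/
theorem algebraMap_mem_cohomologyAnnihilatorOfDegree_four_adicCompletion_of_isRegularLocalRing
    {T' : Type} [CommRing T'] [IsRegularLocalRing T'] (h3 : ringKrullDim T' ≤ (3 : ℕ)) (y : T') :
    algebraMap T' (AdicCompletion (maximalIdeal T') T') y ∈
      cohomologyAnnihilatorOfDegree (AdicCompletion (maximalIdeal T') T') 4 :=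
  mem_cohomologyAnnihilatorOfDegree_four_adicCompletion_of_isRegularLocalRing h3 _

/-! ## Along the tower: CSP″ from its SINGULAR steps -/

variable {k K : Type} [Field k] [Field K] [Algebra k K]

/-- **CSP″ REDUCES TO THE STEPS INTO A SINGULAR STAGE (OURS · w44b-o12′ follow-up).** Along the canonical
normalised `ca`-tower of a surface datum (binders verbatim those of `CompletedStepPersistenceRationalNormal`)
every stage is a noetherian local ring of Krull dimension `≤ 2` (`ringKrullDim_tower_le_of_ringKrullDim_le`),
so at a step `T_m → T_(m+1)` with `T_(m+1)` a REGULAR local ring the completed clause holds by Serre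
(`algebraMap_mem_cohomologyAnnihilatorOfDegree_four_adicCompletion_of_isRegularLocalRing`). Hence the typed
conjecture CSP″ follows from its restriction to the steps whose target stage is NOT regular. [folklore] -/
theorem completedStepPersistenceRationalNormal_of_singularSteps
    (h : ∀ p : ℕ, p.Prime → ∀ (k K : Type) [Field k] [CharP k p] [Field K] [Algebra k K]
      (O : ValuationSubring K) (A : Subalgebra k K), (∀ c : k, algebraMap k K c ∈ O) → A.FG →
      IsFractionRing ↥A K → A.toSubring ≤ O.toSubring → ringKrullDim ↥A ≤ 2 →
      ((IsIntegrallyClosed ↥(tower O A 0) ∧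
          Literature.AlgebraicGeometry.Resolution.HasRationalSingularity ↥(tower O A 0)) ∨
        IsRegularLocalRing ↥(tower O A 0)) →
      ∀ (m : ℕ) (hle : tower O A m ≤ tower O A (m + 1))
        [IsNoetherianRing ↥(tower O A (m + 1))] [IsLocalRing ↥(tower O A (m + 1))],
        ¬ IsRegularLocalRing ↥(tower O A (m + 1)) →
        ∀ (x : ↥(tower O A m)), x ∈ cohomologyAnnihilatorOfDegree ↥(tower O A m) 4 →
        algebraMap ↥(tower O A (m + 1))
            (AdicCompletion (IsLocalRing.maximalIdeal ↥(tower O A (m + 1))) ↥(tower O A (m + 1)))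
            (Subalgebra.inclusion hle x) ∈
          cohomologyAnnihilatorOfDegree
            (AdicCompletion (IsLocalRing.maximalIdeal ↥(tower O A (m + 1))) ↥(tower O A (m + 1))) 4) :
    CompletedStepPersistenceRationalNormal := by
  intro p hp k K _ _ _ _ O A hk hA hfr hAO hdim hRN m hle _ _ x hx
  by_cases hreg : IsRegularLocalRing ↥(tower O A (m + 1))
  · haveI : IsFractionRing ↥A K := hfr
    have hd2 : ringKrullDim ↥(tower O A (m + 1)) ≤ (2 : ℕ) :=
      ringKrullDim_tower_le_of_ringKrullDim_le O A hA (by exact_mod_cast hdim) (m + 1)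
    exact algebraMap_mem_cohomologyAnnihilatorOfDegree_four_adicCompletion_of_isRegularLocalRing
      (hd2.trans (by exact_mod_cast (by norm_num : (2 : ℕ) ≤ 3))) _
  · exact h p hp k K O A hk hA hfr hAO hdim hRN m hle hreg x hx

end Summit.ResolutionOfSingularities.ResolutionOfSingularities.Theorems.HomologicalConductor.PersistenceSurfaceCompletedStep

end
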